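import Literature.MathematicalPhysics.QuantumLattice.WilsonDiracAP
import Summits.QuantumFields.QCD.Theorems.QuarksAsStableActionCriticalLineDiamagnetismStubDeltaBounds
import Summits.QuantumFields.QCD.Theorems.WilsonQuarkChessboardFlatCellOptimalStubTangentDeltaAllN

/-!
# Frobenius and operator bounds for `Δ = D[u·X] − D[u]` (Wilson–Dirac, direction-dependent constant
unitaries), `N` colours
(helper for crux stmt-QuantumFields-9307 `FlatCellOptimal`, line `registered`, stubs
`stub_hessianMarginAllN` / `stub_localNormGain_of`, sub-goal `stub_tangentDeltaBAllN` — the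
`Fin 3 ↦ Fin N` port of the sibling crux stmt-QuantumFields-9734's `…CriticalLineDiamagnetismStubDeltaBounds`
(with the bridge `D[u·X] − D[u] = Δ(X − 1)` of `…StubOneLoopMarginOfAux`), gap G2a, wave 3)

What.  On `(ℤ/L)⁴` (used at `L = 2`), colour `Fin N` for ANY `N : ℕ`, spin `Fin 4`, `r = 1`, mass `m`,
constant direction-dependent unitaries `u : Fin 4 → U(N)` and any `U(N)` link field `X`: the
perturbation `Δ = wilsonDirac ρ_N (fun e => u e.2 * X e) m 1 − wilsonDirac ρ_N (fun e => u e.2) m 1`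
satisfies, with the SAME `N`-free constants as the sibling's `N = 3`,
(F) `Σ_{pq} ‖Δ_{pq}‖² ≤ 64 Σ_e (N − Re tr X_e)` (`frobenius_le`) and
(op) `Σ_p ‖(Δ v)_p‖² ≤ 256 η Σ_p ‖v_p‖²` whenever every link deficit `N − Re tr X_e ≤ η` (`op_le`);
the registered sub-goal `stub_tangentDeltaBAllN` is (F) ∧ (op) (the sibling's `stub_deltaBounds` with
`C_F = 64`, `C_op = 256`, every `N`, every `L`).

How.  The mass/Wilson diagonal cancels (`wilsonDirac_dir_sub_apply`): `Δ_{pq} = −½ Σ_μ (F_μ + B_μ)`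
with hops `F_μ(p,q) = [q.1 = p.1 + e_μ] (1 − γ_μ)_{p₂q₂} (u_μ (X_{p.1,μ} − 1))_{p₁q₁}`,
`B_μ(p,q) = [p.1 = q.1 + e_μ] (1 + γ_μ)_{p₂q₂} ((u_μ (X_{q.1,μ} − 1))ᴴ)_{p₁q₁}` (`rep_mul_sub`,
`rep_mul_inv_sub`; as a matrix identity `Δ = Δ(X − 1)`, the hopping form `Dl` of the lead's skeleton,
`wilsonDirac_dir_sub_eq`); the colour factors have Frobenius sum `2 (N − Re tr X_e)` (unitary
invariance + `TangentDelta.sum_norm_sq_sub_one`), the spin factors `‖1 ∓ γ_μ‖_F² = 8`.  Generic kernel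
bounds come first (`frob_kernel_le`: `‖K‖_F² ≤ 2 Σ_μ (‖G⁻_μ‖_F² Σ_x ‖C^f_μ(x)‖_F² + ‖G⁺_μ‖_F² Σ_x ‖C^b_μ(x)‖_F²)`;
`op_kernel_le`: blockwise Cauchy–Schwarz, `Σ_p ‖(Kv)_p‖² ≤ 16 K Σ‖v‖²` if every block has
`‖G‖_F² ‖C(x)‖_F² ≤ K`; arbitrary spin factors `G^∓_μ` and colour factors `C^{f,b}_μ(x) ∈ M_N(ℂ)`, so
with `C^f_μ(x) = u_μ E(x,μ)`, `C^b_μ(y) = (u_μ E(y,μ))ᴴ` also `‖Δ(E)‖_F² ≤ 32 Σ_e ‖E_e‖_F²` for any link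
field `E`, as in the sibling `…StubBilinearBounds`).  The argument is colour-ENTRYWISE, so no constant
depends on `N`; the port is textual (`Fin 3 ↦ Fin N`), and the colour-free lemmas of the sibling
(`‖1 ∓ γ_μ‖_F² = 8`, the eight-term inequality, a sum interchange) are re-EXPORTED (no restatement).
References: Montvay–Münster, *Quantum Fields on a Lattice* §4.2; folklore linear algebra.  No `def`s.
-/

noncomputable section

open scoped BigOperators Classical Matrix ComplexConjugate
open Finset
open Literature.MathematicalPhysics.QuantumLattice Literature.MathematicalPhysics.QuantumFieldTheory
  Literature.Probability.LatticeModels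

namespace Summit.QuantumFields.QCD.Cruxes.FlatCellOptimal.TangentDelta

/-! ### Colour-free lemmas of the sibling file, re-exported -/

export Summit.QuantumFields.QCD.Cruxes.CriticalLineDiamagnetism.ChessboardCellGain.StubDeltaBounds
  (sum_norm_sq_one_sub_gamma sum_norm_sq_one_add_gamma norm_sq_half_sum_le sum_sum_const_mul_sum_comm)

variable {N L : ℕ}

/-! ### Entries of `D[u·X] − D[u]` -/

/-- **Entries of the perturbation** `Δ = D[u·X] − D[u]` (`N` colours): the diagonal (mass + Wilson)
part cancels and the hopping blocks subtract. -/
theorem wilsonDirac_dir_sub_apply (u : Fin 4 → Matrix.unitaryGroup (Fin N) ℂ)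
    (X : GaugeConfig 4 L (Matrix.unitaryGroup (Fin N) ℂ)) (m : ℝ)
    (p q : TorusSite 4 L × Fin N × Fin 4) :
    (wilsonDirac (unitaryFundamentalRep (Fin N) ℂ) (fun e : Edge 4 L => u e.2 * X e) m 1 -
        wilsonDirac (unitaryFundamentalRep (Fin N) ℂ) (fun e : Edge 4 L => u e.2) m 1) p q =
      -(1 / 2 : ℂ) * ∑ μ : Fin 4,
        ((if q.1 = Site.shift p.1 μ then
            ((1 : Matrix (Fin 4) (Fin 4) ℂ) - euclideanGamma μ) p.2.2 q.2.2 *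
              (unitaryFundamentalRep (Fin N) ℂ (u μ * X (p.1, μ)) -
                unitaryFundamentalRep (Fin N) ℂ (u μ)) p.2.1 q.2.1 else 0) +
          (if p.1 = Site.shift q.1 μ then
            ((1 : Matrix (Fin 4) (Fin 4) ℂ) + euclideanGamma μ) p.2.2 q.2.2 *
              (unitaryFundamentalRep (Fin N) ℂ (u μ * X (q.1, μ))⁻¹ -
                unitaryFundamentalRep (Fin N) ℂ (u μ)⁻¹) p.2.1 q.2.1 else 0)) := by
  -- adapted from the sibling `StubDeltaBounds.wilsonDirac_dir_sub_apply` (`Fin 3 ↦ Fin N`)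
  rw [Matrix.sub_apply]
  simp only [wilsonDirac, Matrix.of_apply, Complex.ofReal_one, one_smul]
  rw [sub_sub_sub_cancel_left, ← mul_sub, ← Finset.sum_sub_distrib, neg_mul, ← mul_neg,
    ← Finset.sum_neg_distrib]
  refine congrArg₂ (· * ·) rfl (Finset.sum_congr rfl fun μ _ => ?_)
  split_ifs <;> (try simp only [Matrix.sub_apply, mul_sub]) <;> ring

/-- `ρ(u g) − ρ(u) = u (g − 1)` on `U(N)`. -/
theorem rep_mul_sub (u g : Matrix.unitaryGroup (Fin N) ℂ) :
    unitaryFundamentalRep (Fin N) ℂ (u * g) - unitaryFundamentalRep (Fin N) ℂ u =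
      (u : Matrix (Fin N) (Fin N) ℂ) * ((g : Matrix (Fin N) (Fin N) ℂ) - 1) := by
  simp only [unitaryFundamentalRep_apply, Matrix.UnitaryGroup.mul_val]
  rw [Matrix.mul_sub, Matrix.mul_one]

/-- `ρ((u g)⁻¹) − ρ(u⁻¹) = (u (g − 1))ᴴ` on `U(N)`. -/
theorem rep_mul_inv_sub (u g : Matrix.unitaryGroup (Fin N) ℂ) :
    unitaryFundamentalRep (Fin N) ℂ (u * g)⁻¹ - unitaryFundamentalRep (Fin N) ℂ u⁻¹ =
      ((u : Matrix (Fin N) (Fin N) ℂ) * ((g : Matrix (Fin N) (Fin N) ℂ) - 1))ᴴ := by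
  simp only [unitaryFundamentalRep_apply, Matrix.UnitaryGroup.inv_val, Matrix.UnitaryGroup.mul_val]
  rw [Matrix.mul_sub, Matrix.mul_one, ← Matrix.star_eq_conjTranspose, star_sub]

/-- **`D[u·X] − D[u] = Δ(X − 1)`** (`N` colours): the perturbation of the `r = 1` Wilson–Dirac operator with
constant direction-dependent unitaries `u` by a link field `X` is the hopping form `Dl` of `X − 1`. -/
theorem wilsonDirac_dir_sub_eq (u : Fin 4 → Matrix.unitaryGroup (Fin N) ℂ)
    (X : GaugeConfig 4 L (Matrix.unitaryGroup (Fin N) ℂ)) (m : ℝ)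
    (E : Edge 4 L → Matrix (Fin N) (Fin N) ℂ)
    (hE : ∀ e, E e = ((X e : Matrix.unitaryGroup (Fin N) ℂ) : Matrix (Fin N) (Fin N) ℂ) - 1) :
    wilsonDirac (unitaryFundamentalRep (Fin N) ℂ) (fun e : Edge 4 L => u e.2 * X e) m 1 -
        wilsonDirac (unitaryFundamentalRep (Fin N) ℂ) (fun e : Edge 4 L => u e.2) m 1 =
      Matrix.of fun p q : TorusSite 4 L × Fin N × Fin 4 => -(1 / 2 : ℂ) * ∑ μ : Fin 4,
        ((if q.1 = Site.shift p.1 μ then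
            ((1 : Matrix (Fin 4) (Fin 4) ℂ) - euclideanGamma μ) p.2.2 q.2.2 *
              (((u μ : Matrix.unitaryGroup (Fin N) ℂ) : Matrix (Fin N) (Fin N) ℂ) * E (p.1, μ))
                p.2.1 q.2.1 else 0) +
          (if p.1 = Site.shift q.1 μ then
            ((1 : Matrix (Fin 4) (Fin 4) ℂ) + euclideanGamma μ) p.2.2 q.2.2 *
              (((u μ : Matrix.unitaryGroup (Fin N) ℂ) : Matrix (Fin N) (Fin N) ℂ) * E (q.1, μ))ᴴ
                p.2.1 q.2.1 else 0)) := by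
  ext p q
  rw [wilsonDirac_dir_sub_apply, Matrix.of_apply]
  simp only [rep_mul_sub, rep_mul_inv_sub, hE]

/-! ### Frobenius sums of colour factors -/

/-- Left multiplication by a unitary preserves the Frobenius sum (`N` colours). -/
theorem sum_norm_sq_unitary_mul (u : Matrix.unitaryGroup (Fin N) ℂ) (M : Matrix (Fin N) (Fin N) ℂ) :
    ∑ a, ∑ b, ‖((u : Matrix (Fin N) (Fin N) ℂ) * M) a b‖ ^ 2 = ∑ a, ∑ b, ‖M a b‖ ^ 2 := by
  rw [sum_norm_sq_eq_re_trace_conjTranspose_mul_self,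
    sum_norm_sq_eq_re_trace_conjTranspose_mul_self, Matrix.conjTranspose_mul, Matrix.mul_assoc,
    ← Matrix.mul_assoc _ (u : Matrix (Fin N) (Fin N) ℂ) M,
    show (u : Matrix (Fin N) (Fin N) ℂ)ᴴ * (u : Matrix (Fin N) (Fin N) ℂ) = 1 from
      Matrix.UnitaryGroup.star_mul_self u, Matrix.one_mul]

/-- The Frobenius sum is invariant under the conjugate transpose (`N` colours). -/
theorem sum_norm_sq_conjTranspose (M : Matrix (Fin N) (Fin N) ℂ) :
    ∑ a, ∑ b, ‖Mᴴ a b‖ ^ 2 = ∑ a, ∑ b, ‖M a b‖ ^ 2 := by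
  rw [Finset.sum_comm]
  simp only [Matrix.conjTranspose_apply, norm_star]

/-- Forward colour factor: `ρ(u g) − ρ(u) = u (g − 1)` has Frobenius sum `2 (N − Re tr g)`. -/
theorem sum_norm_sq_rep_mul_sub (u g : Matrix.unitaryGroup (Fin N) ℂ) :
    ∑ a, ∑ b, ‖(unitaryFundamentalRep (Fin N) ℂ (u * g) -
        unitaryFundamentalRep (Fin N) ℂ u) a b‖ ^ 2 =
      2 * ((N : ℝ) - ((g : Matrix (Fin N) (Fin N) ℂ)).trace.re) := by
  rw [rep_mul_sub, sum_norm_sq_unitary_mul, sum_norm_sq_sub_one]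

/-- Backward colour factor: `ρ((u g)⁻¹) − ρ(u⁻¹) = (u (g − 1))ᴴ` has Frobenius sum `2 (N − Re tr g)`. -/
theorem sum_norm_sq_rep_mul_inv_sub (u g : Matrix.unitaryGroup (Fin N) ℂ) :
    ∑ a, ∑ b, ‖(unitaryFundamentalRep (Fin N) ℂ (u * g)⁻¹ -
        unitaryFundamentalRep (Fin N) ℂ u⁻¹) a b‖ ^ 2 =
      2 * ((N : ℝ) - ((g : Matrix (Fin N) (Fin N) ℂ)).trace.re) := by
  rw [rep_mul_inv_sub, sum_norm_sq_conjTranspose, sum_norm_sq_unitary_mul, sum_norm_sq_sub_one]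

/-! ### Generic hopping kernels (colour `Fin N`, spin `Fin 4`) -/

/-- Frobenius sum of a colour–spin block `(t, s) ↦ G_{t₂ s₂} C_{t₁ s₁}`: `‖G‖_F² ‖C‖_F²`. -/
theorem sum_norm_sq_block (G : Matrix (Fin 4) (Fin 4) ℂ) (C : Matrix (Fin N) (Fin N) ℂ) :
    ∑ t : Fin N × Fin 4, ∑ s : Fin N × Fin 4, ‖G t.2 s.2 * C t.1 s.1‖ ^ 2 =
      (∑ α, ∑ β, ‖G α β‖ ^ 2) * ∑ a, ∑ b, ‖C a b‖ ^ 2 := by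
  simp only [Fintype.sum_prod_type, norm_mul, mul_pow, Finset.sum_mul_sum]
  rw [Finset.sum_comm]
  refine Finset.sum_congr rfl fun α _ => Finset.sum_congr rfl fun a _ => ?_
  rw [Finset.sum_comm]

/-- Cauchy–Schwarz for a colour–spin block acting on a colour–spin vector:
`Σ_t ‖Σ_s G_{t₂ s₂} C_{t₁ s₁} w_s‖² ≤ ‖G‖_F² ‖C‖_F² Σ_s ‖w_s‖²`. -/
theorem sum_norm_sq_block_mul_le (G : Matrix (Fin 4) (Fin 4) ℂ) (C : Matrix (Fin N) (Fin N) ℂ)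
    (w : Fin N × Fin 4 → ℂ) :
    ∑ t : Fin N × Fin 4, ‖∑ s : Fin N × Fin 4, G t.2 s.2 * C t.1 s.1 * w s‖ ^ 2 ≤
      (∑ α, ∑ β, ‖G α β‖ ^ 2) * (∑ a, ∑ b, ‖C a b‖ ^ 2) * ∑ s, ‖w s‖ ^ 2 := by
  rw [← sum_norm_sq_block, Finset.sum_mul]
  refine Finset.sum_le_sum fun t _ => ?_
  calc ‖∑ s : Fin N × Fin 4, G t.2 s.2 * C t.1 s.1 * w s‖ ^ 2
      ≤ (∑ s : Fin N × Fin 4, ‖G t.2 s.2 * C t.1 s.1‖ * ‖w s‖) ^ 2 :=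
        pow_le_pow_left₀ (norm_nonneg _) ((norm_sum_le _ _).trans
          (le_of_eq (Finset.sum_congr rfl fun s _ => norm_mul _ _))) 2
    _ ≤ (∑ s : Fin N × Fin 4, ‖G t.2 s.2 * C t.1 s.1‖ ^ 2) * ∑ s, ‖w s‖ ^ 2 :=
        Finset.sum_mul_sq_le_sq_mul_sq _ _ _

variable [NeZero L]

/-- Forward blocks on a vector: the column sum picks the site `y`. -/
theorem sum_ite_site_mul (y : TorusSite 4 L) (g : Fin N × Fin 4 → ℂ)
    (v : TorusSite 4 L × Fin N × Fin 4 → ℂ) :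
    ∑ q : TorusSite 4 L × Fin N × Fin 4, (if q.1 = y then g q.2 else 0) * v q =
      ∑ s, g s * v (y, s) := by
  rw [Fintype.sum_prod_type, Finset.sum_eq_single y (fun x _ hx => by simp [hx]) (by simp)]
  simp

/-- Backward blocks on a vector: the column sum picks the site `x − e_μ`. -/
theorem sum_ite_shift_mul (x : TorusSite 4 L) (μ : Fin 4)
    (g : TorusSite 4 L → Fin N × Fin 4 → ℂ) (v : TorusSite 4 L × Fin N × Fin 4 → ℂ) :
    ∑ q : TorusSite 4 L × Fin N × Fin 4, (if x = Site.shift q.1 μ then g q.1 q.2 else 0) * v q =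
      ∑ s, g (x - Pi.single μ 1) s * v (x - Pi.single μ 1, s) := by
  simp_rw [eq_shift_iff' x]
  rw [Fintype.sum_prod_type,
    Finset.sum_eq_single (x - Pi.single μ 1) (fun y _ hy => by simp [hy]) (by simp)]
  simp

/-- Forward blocks: the Frobenius column sum picks the site `y`. -/
theorem sum_norm_sq_ite_site (y : TorusSite 4 L) (g : Fin N × Fin 4 → ℂ) :
    ∑ q : TorusSite 4 L × Fin N × Fin 4, ‖(if q.1 = y then g q.2 else 0)‖ ^ 2 =
      ∑ s, ‖g s‖ ^ 2 := by
  rw [Fintype.sum_prod_type, Finset.sum_eq_single y (fun x _ hx => by simp [hx]) (by simp)]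
  simp

/-- Backward blocks: the Frobenius column sum picks the site `x − e_μ`. -/
theorem sum_norm_sq_ite_shift (x : TorusSite 4 L) (μ : Fin 4)
    (g : TorusSite 4 L → Fin N × Fin 4 → ℂ) :
    ∑ q : TorusSite 4 L × Fin N × Fin 4, ‖(if x = Site.shift q.1 μ then g q.1 q.2 else 0)‖ ^ 2 =
      ∑ s, ‖g (x - Pi.single μ 1) s‖ ^ 2 := by
  simp_rw [eq_shift_iff' x]
  rw [Fintype.sum_prod_type,
    Finset.sum_eq_single (x - Pi.single μ 1) (fun y _ hy => by simp [hy]) (by simp)]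
  simp

/-- **Frobenius sum of a hopping kernel** (`N` colours): the kernel `K(p,q) = −½ Σ_μ ([q.1 = p.1 + e_μ]
G⁻_μ ⊗ C^f_μ(p.1) + [p.1 = q.1 + e_μ] G⁺_μ ⊗ C^b_μ(q.1))` has
`‖K‖_F² ≤ 2 Σ_μ (‖G⁻_μ‖_F² Σ_x ‖C^f_μ(x)‖_F² + ‖G⁺_μ‖_F² Σ_x ‖C^b_μ(x)‖_F²)`. -/
theorem frob_kernel_le (Gm Gp : Fin 4 → Matrix (Fin 4) (Fin 4) ℂ)
    (Cf Cb : Fin 4 → TorusSite 4 L → Matrix (Fin N) (Fin N) ℂ) :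
    ∑ p : TorusSite 4 L × Fin N × Fin 4, ∑ q : TorusSite 4 L × Fin N × Fin 4,
      ‖-(1 / 2 : ℂ) * ∑ μ, ((if q.1 = Site.shift p.1 μ then
          Gm μ p.2.2 q.2.2 * Cf μ p.1 p.2.1 q.2.1 else 0) +
        (if p.1 = Site.shift q.1 μ then Gp μ p.2.2 q.2.2 * Cb μ q.1 p.2.1 q.2.1 else 0))‖ ^ 2 ≤
      2 * ∑ μ, ((∑ α, ∑ β, ‖Gm μ α β‖ ^ 2) * ∑ x, ∑ a, ∑ b, ‖Cf μ x a b‖ ^ 2 +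
        (∑ α, ∑ β, ‖Gp μ α β‖ ^ 2) * ∑ x, ∑ a, ∑ b, ‖Cb μ x a b‖ ^ 2) := by
  -- adapted from the sibling `StubDeltaBounds.frob_kernel_le` (`Fin 3 ↦ Fin N`, textual)
  have hF : ∀ μ, ∑ p : TorusSite 4 L × Fin N × Fin 4, ∑ q : TorusSite 4 L × Fin N × Fin 4,
      ‖(if q.1 = Site.shift p.1 μ then Gm μ p.2.2 q.2.2 * Cf μ p.1 p.2.1 q.2.1 else 0)‖ ^ 2 =
        (∑ α, ∑ β, ‖Gm μ α β‖ ^ 2) * ∑ x, ∑ a, ∑ b, ‖Cf μ x a b‖ ^ 2 := fun μ => by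
    have hx : ∀ x : TorusSite 4 L, ∑ t : Fin N × Fin 4, ∑ q : TorusSite 4 L × Fin N × Fin 4,
        ‖(if q.1 = Site.shift x μ then Gm μ t.2 q.2.2 * Cf μ x t.1 q.2.1 else 0)‖ ^ 2 =
          (∑ α, ∑ β, ‖Gm μ α β‖ ^ 2) * ∑ a, ∑ b, ‖Cf μ x a b‖ ^ 2 := fun x => by
      rw [← sum_norm_sq_block]
      exact Finset.sum_congr rfl fun t _ =>
        sum_norm_sq_ite_site (Site.shift x μ) (fun s => Gm μ t.2 s.2 * Cf μ x t.1 s.1)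
    rw [Fintype.sum_prod_type]
    simp only [hx]
    rw [Finset.mul_sum]
  have hB : ∀ μ, ∑ p : TorusSite 4 L × Fin N × Fin 4, ∑ q : TorusSite 4 L × Fin N × Fin 4,
      ‖(if p.1 = Site.shift q.1 μ then Gp μ p.2.2 q.2.2 * Cb μ q.1 p.2.1 q.2.1 else 0)‖ ^ 2 =
        (∑ α, ∑ β, ‖Gp μ α β‖ ^ 2) * ∑ x, ∑ a, ∑ b, ‖Cb μ x a b‖ ^ 2 := fun μ => by
    have hx : ∀ x : TorusSite 4 L, ∑ t : Fin N × Fin 4, ∑ q : TorusSite 4 L × Fin N × Fin 4,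
        ‖(if x = Site.shift q.1 μ then Gp μ t.2 q.2.2 * Cb μ q.1 t.1 q.2.1 else 0)‖ ^ 2 =
          (∑ α, ∑ β, ‖Gp μ α β‖ ^ 2) * ∑ a, ∑ b, ‖Cb μ (x - Pi.single μ 1) a b‖ ^ 2 :=
      fun x => by
      rw [← sum_norm_sq_block]
      exact Finset.sum_congr rfl fun t _ =>
        sum_norm_sq_ite_shift x μ (fun y s => Gp μ t.2 s.2 * Cb μ y t.1 s.1)
    rw [Fintype.sum_prod_type]
    simp only [hx]
    rw [Finset.mul_sum]
    exact Equiv.sum_comp (Equiv.subRight (Pi.single μ (1 : ZMod L)))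
      (fun x => (∑ α, ∑ β, ‖Gp μ α β‖ ^ 2) * ∑ a, ∑ b, ‖Cb μ x a b‖ ^ 2)
  refine (Finset.sum_le_sum fun p _ => Finset.sum_le_sum fun q _ =>
    norm_sq_half_sum_le _ _).trans (le_of_eq ?_)
  rw [sum_sum_const_mul_sum_comm]
  congr 1
  refine Finset.sum_congr rfl fun μ _ => ?_
  rw [← hF μ, ← hB μ]
  simp_rw [Finset.sum_add_distrib]

/-- **A hopping kernel on a vector** (`N` colours): blocks `‖G‖_F² ‖C(x)‖_F² ≤ K ⇒ Σ_p ‖(Kv)_p‖² ≤ 16 K Σ‖v‖²`. -/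
theorem op_kernel_le (Gm Gp : Fin 4 → Matrix (Fin 4) (Fin 4) ℂ)
    (Cf Cb : Fin 4 → TorusSite 4 L → Matrix (Fin N) (Fin N) ℂ) (K : ℝ)
    (hKf : ∀ μ x, (∑ α, ∑ β, ‖Gm μ α β‖ ^ 2) * ∑ a, ∑ b, ‖Cf μ x a b‖ ^ 2 ≤ K)
    (hKb : ∀ μ x, (∑ α, ∑ β, ‖Gp μ α β‖ ^ 2) * ∑ a, ∑ b, ‖Cb μ x a b‖ ^ 2 ≤ K)
    (v : TorusSite 4 L × Fin N × Fin 4 → ℂ) :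
    ∑ p : TorusSite 4 L × Fin N × Fin 4, ‖∑ q : TorusSite 4 L × Fin N × Fin 4,
      (-(1 / 2 : ℂ) * ∑ μ, ((if q.1 = Site.shift p.1 μ then
          Gm μ p.2.2 q.2.2 * Cf μ p.1 p.2.1 q.2.1 else 0) +
        (if p.1 = Site.shift q.1 μ then Gp μ p.2.2 q.2.2 * Cb μ q.1 p.2.1 q.2.1 else 0))) *
        v q‖ ^ 2 ≤
      16 * K * ∑ i, ‖v i‖ ^ 2 := by
  -- adapted from the sibling `StubDeltaBounds.op_kernel_le`; the kernel applied to `v`, site sums collapsed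
  have hmv : ∀ p : TorusSite 4 L × Fin N × Fin 4, ∑ q : TorusSite 4 L × Fin N × Fin 4,
      (-(1 / 2 : ℂ) * ∑ μ, ((if q.1 = Site.shift p.1 μ then
          Gm μ p.2.2 q.2.2 * Cf μ p.1 p.2.1 q.2.1 else 0) +
        (if p.1 = Site.shift q.1 μ then Gp μ p.2.2 q.2.2 * Cb μ q.1 p.2.1 q.2.1 else 0))) *
        v q =
      -(1 / 2 : ℂ) * ∑ μ,
        ((∑ s : Fin N × Fin 4, Gm μ p.2.2 s.2 * Cf μ p.1 p.2.1 s.1 * v (Site.shift p.1 μ, s)) +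
          ∑ s : Fin N × Fin 4, Gp μ p.2.2 s.2 * Cb μ (p.1 - Pi.single μ 1) p.2.1 s.1 *
            v (p.1 - Pi.single μ 1, s)) := by
    intro p
    simp_rw [mul_assoc (-(1 / 2 : ℂ)), ← Finset.mul_sum]
    congr 1
    simp_rw [Finset.sum_mul, add_mul]
    rw [Finset.sum_comm]
    refine Finset.sum_congr rfl fun μ _ => ?_
    rw [Finset.sum_add_distrib,
      sum_ite_site_mul (Site.shift p.1 μ) (fun s => Gm μ p.2.2 s.2 * Cf μ p.1 p.2.1 s.1) v,
      sum_ite_shift_mul p.1 μ (fun y s => Gp μ p.2.2 s.2 * Cb μ y p.2.1 s.1) v]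
  -- the forward blocks
  have hAf : ∀ μ, ∑ p : TorusSite 4 L × Fin N × Fin 4,
      ‖∑ s : Fin N × Fin 4, Gm μ p.2.2 s.2 * Cf μ p.1 p.2.1 s.1 * v (Site.shift p.1 μ, s)‖ ^ 2 ≤
        K * ∑ i, ‖v i‖ ^ 2 := fun μ => by
    rw [Fintype.sum_prod_type]
    dsimp only
    refine (Finset.sum_le_sum fun x _ =>
      (sum_norm_sq_block_mul_le (Gm μ) (Cf μ x) (fun s => v (Site.shift x μ, s))).trans
        (mul_le_mul_of_nonneg_right (hKf μ x) (Finset.sum_nonneg fun s _ => sq_nonneg _))).trans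
      (le_of_eq ?_)
    rw [← Finset.mul_sum]
    congr 1
    rw [Fintype.sum_prod_type]
    exact Equiv.sum_comp (Equiv.addRight (Pi.single μ (1 : ZMod L)))
      (fun x => ∑ s : Fin N × Fin 4, ‖v (x, s)‖ ^ 2)
  -- the backward blocks
  have hAb : ∀ μ, ∑ p : TorusSite 4 L × Fin N × Fin 4,
      ‖∑ s : Fin N × Fin 4, Gp μ p.2.2 s.2 * Cb μ (p.1 - Pi.single μ 1) p.2.1 s.1 *
        v (p.1 - Pi.single μ 1, s)‖ ^ 2 ≤ K * ∑ i, ‖v i‖ ^ 2 := fun μ => by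
    rw [Fintype.sum_prod_type]
    dsimp only
    refine (Finset.sum_le_sum fun x _ =>
      (sum_norm_sq_block_mul_le (Gp μ) (Cb μ (x - Pi.single μ 1))
        (fun s => v (x - Pi.single μ 1, s))).trans
        (mul_le_mul_of_nonneg_right (hKb μ (x - Pi.single μ 1))
          (Finset.sum_nonneg fun s _ => sq_nonneg _))).trans (le_of_eq ?_)
    rw [← Finset.mul_sum]
    congr 1
    rw [Fintype.sum_prod_type]
    exact Equiv.sum_comp (Equiv.subRight (Pi.single μ (1 : ZMod L)))
      (fun x => ∑ s : Fin N × Fin 4, ‖v (x, s)‖ ^ 2)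
  simp_rw [hmv]
  refine (Finset.sum_le_sum fun p _ => norm_sq_half_sum_le _ _).trans ?_
  rw [← Finset.mul_sum, Finset.sum_comm]
  simp_rw [Finset.sum_add_distrib]
  refine (mul_le_mul_of_nonneg_left (add_le_add (Finset.sum_le_sum fun μ _ => hAf μ)
    (Finset.sum_le_sum fun μ _ => hAb μ)) (zero_le_two : (0 : ℝ) ≤ 2)).trans (le_of_eq ?_)
  rw [Finset.sum_const, Finset.card_univ, Fintype.card_fin, nsmul_eq_mul]
  push_cast
  ring

/-! ### `Δ = D[u·X] − D[u]`: the bounds in terms of the link deficits -/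

/-- **(F) Frobenius bound** (`N` colours, `N`-free constant): `Σ_{pq} ‖Δ_{pq}‖² ≤ 64 Σ_e (N − Re tr X_e)`. -/
theorem frobenius_le (u : Fin 4 → Matrix.unitaryGroup (Fin N) ℂ)
    (X : GaugeConfig 4 L (Matrix.unitaryGroup (Fin N) ℂ)) (m : ℝ) :
    ∑ p, ∑ q, ‖(wilsonDirac (unitaryFundamentalRep (Fin N) ℂ) (fun e : Edge 4 L => u e.2 * X e) m 1 -
        wilsonDirac (unitaryFundamentalRep (Fin N) ℂ) (fun e : Edge 4 L => u e.2) m 1) p q‖ ^ 2 ≤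
      64 * ∑ e : Edge 4 L, ((N : ℝ) - ((X e : Matrix (Fin N) (Fin N) ℂ)).trace.re) := by
  have h := frob_kernel_le (L := L) (fun μ => (1 : Matrix (Fin 4) (Fin 4) ℂ) - euclideanGamma μ)
    (fun μ => (1 : Matrix (Fin 4) (Fin 4) ℂ) + euclideanGamma μ)
    (fun μ x => unitaryFundamentalRep (Fin N) ℂ (u μ * X (x, μ)) -
      unitaryFundamentalRep (Fin N) ℂ (u μ))
    (fun μ y => unitaryFundamentalRep (Fin N) ℂ (u μ * X (y, μ))⁻¹ -
      unitaryFundamentalRep (Fin N) ℂ (u μ)⁻¹)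
  simp only [sum_norm_sq_one_sub_gamma, sum_norm_sq_one_add_gamma, sum_norm_sq_rep_mul_sub,
    sum_norm_sq_rep_mul_inv_sub] at h
  simp_rw [wilsonDirac_dir_sub_apply]
  refine h.trans (le_of_eq ?_)
  rw [Fintype.sum_prod_type, Finset.sum_comm, Finset.mul_sum, Finset.mul_sum]
  refine Finset.sum_congr rfl fun μ _ => ?_
  rw [← Finset.mul_sum]
  ring

/-- **(op) Operator bound** (`N` colours, `N`-free constant): if every link deficit is `≤ η`, then
`Σ_p ‖(Δ v)_p‖² ≤ 256 η Σ_p ‖v_p‖²`. -/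
theorem op_le (u : Fin 4 → Matrix.unitaryGroup (Fin N) ℂ)
    (X : GaugeConfig 4 L (Matrix.unitaryGroup (Fin N) ℂ)) (m η : ℝ)
    (hη : ∀ e, (N : ℝ) - ((X e : Matrix.unitaryGroup (Fin N) ℂ) : Matrix (Fin N) (Fin N) ℂ).trace.re ≤ η)
    (v : TorusSite 4 L × Fin N × Fin 4 → ℂ) :
    ∑ p, ‖((wilsonDirac (unitaryFundamentalRep (Fin N) ℂ) (fun e : Edge 4 L => u e.2 * X e) m 1 -
        wilsonDirac (unitaryFundamentalRep (Fin N) ℂ) (fun e : Edge 4 L => u e.2) m 1).mulVec v) p‖ ^ 2 ≤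
      256 * η * ∑ i, ‖v i‖ ^ 2 := by
  have hKf : ∀ (μ : Fin 4) (x : TorusSite 4 L),
      (∑ α, ∑ β, ‖((1 : Matrix (Fin 4) (Fin 4) ℂ) - euclideanGamma μ) α β‖ ^ 2) *
        ∑ a, ∑ b, ‖(unitaryFundamentalRep (Fin N) ℂ (u μ * X (x, μ)) -
          unitaryFundamentalRep (Fin N) ℂ (u μ)) a b‖ ^ 2 ≤ 16 * η := fun μ x => by
    rw [sum_norm_sq_one_sub_gamma, sum_norm_sq_rep_mul_sub]
    have := hη (x, μ)
    linarith
  have hKb : ∀ (μ : Fin 4) (x : TorusSite 4 L),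
      (∑ α, ∑ β, ‖((1 : Matrix (Fin 4) (Fin 4) ℂ) + euclideanGamma μ) α β‖ ^ 2) *
        ∑ a, ∑ b, ‖(unitaryFundamentalRep (Fin N) ℂ (u μ * X (x, μ))⁻¹ -
          unitaryFundamentalRep (Fin N) ℂ (u μ)⁻¹) a b‖ ^ 2 ≤ 16 * η := fun μ x => by
    rw [sum_norm_sq_one_add_gamma, sum_norm_sq_rep_mul_inv_sub]
    have := hη (x, μ)
    linarith
  have h := op_kernel_le (L := L) (fun μ => (1 : Matrix (Fin 4) (Fin 4) ℂ) - euclideanGamma μ)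
    (fun μ => (1 : Matrix (Fin 4) (Fin 4) ℂ) + euclideanGamma μ)
    (fun μ x => unitaryFundamentalRep (Fin N) ℂ (u μ * X (x, μ)) -
      unitaryFundamentalRep (Fin N) ℂ (u μ))
    (fun μ y => unitaryFundamentalRep (Fin N) ℂ (u μ * X (y, μ))⁻¹ -
      unitaryFundamentalRep (Fin N) ℂ (u μ)⁻¹) (16 * η) hKf hKb v
  simp only [Matrix.mulVec, dotProduct]
  simp_rw [wilsonDirac_dir_sub_apply]
  refine h.trans (le_of_eq ?_)
  ring

/-- **Registered sub-goal of this file** (`stub_tangentDeltaBAllN`, the sibling's `stub_deltaBounds`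
for every colour number `N`, every torus size `L` and with the explicit `N`-free constants
`C_F = 64`, `C_op = 256`): for constant direction-dependent unitaries `u_μ ∈ U(N)` and any `U(N)`
field `X`, the perturbation `Δ = D[u·X] − D[u]` of the `r = 1` Wilson–Dirac operator obeys
`Σ_{ij} ‖Δ_{ij}‖² ≤ 64 Σ_e (N − Re tr X_e)` and, whenever all link deficits are `≤ η`,
`Σ_i ‖(Δ v)_i‖² ≤ 256 η Σ_i ‖v_i‖²`. -/
theorem stub_tangentDeltaBAllN : ∀ (N L : ℕ) [NeZero L] (m : ℝ) (u : Fin 4 → Matrix.unitaryGroup (Fin N) ℂ) (X : GaugeConfig 4 L (Matrix.unitaryGroup (Fin N) ℂ)) (Δ : Matrix (TorusSite 4 L × Fin N × Fin 4) (TorusSite 4 L × Fin N × Fin 4) ℂ), Δ = wilsonDirac (unitaryFundamentalRep (Fin N) ℂ) (fun e : Edge 4 L => u e.2 * X e) m 1 - wilsonDirac (unitaryFundamentalRep (Fin N) ℂ) (fun e : Edge 4 L => u e.2) m 1 → (∑ i, ∑ j, ‖Δ i j‖ ^ 2 ≤ 64 * ∑ e : Edge 4 L, ((N : ℝ) - ((X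 e : Matrix.unitaryGroup (Fin N) ℂ) : Matrix (Fin N) (Fin N) ℂ).trace.re)) ∧ ∀ η : ℝ, (∀ e, (N : ℝ) - ((X e : Matrix.unitaryGroup (Fin N) ℂ) : Matrix (Fin N) (Fin N) ℂ).trace.re ≤ η) → ∀ v : TorusSite 4 L × Fin N × Fin 4 → ℂ, ∑ i, ‖(Δ.mulVec v) i‖ ^ 2 ≤ 256 * η * ∑ i, ‖v i‖ ^ 2 := by
  intro N L _ m u X Δ hΔ
  subst hΔ
  exact ⟨frobenius_le u X m, fun η hη v => op_le u X m η hη v⟩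

end Summit.QuantumFields.QCD.Cruxes.FlatCellOptimal.TangentDelta

end
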